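import Summits.ValiantsHypothesis.ValiantsHypothesis.Theorems.KPlusLogSqLawTridiagonalRealStaticUnitSturmWindowCount
import Summits.ValiantsHypothesis.ValiantsHypothesis.Theorems.KPlusLogSqLawTridiagonalRealStaticUnitSmall

/-!
# Route «KPlusLogSqLaw», crux `WeakLifting` (stmt-ValiantsHypothesis-19561) — REAL side of the tridiagonal sector:
# the UNIT-COEFFICIENT sub-sector — EXACTLY `⌊m/3⌋` ZEROS IN THE RECESSIVE UNIT INTERVAL (one-signed designs, `3 ≤ m ≤ 8`, all exponents)

HONEST FRAMING.  Helper theorems (`--supports stmt-ValiantsHypothesis-19561 --as helper`), seat val-sym-lift-p1 (g18), cell `pub-symmetroid`,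
2026-08-28; the end-point analysis completing `…UnitSturmWindowCount` (zeros below a scale = Sturm count).  Continuants
`D_k = pathDet (fun _ => 1) d (fun _ => 1) f k`; all slopes positive (`d_k + d_{k+1} < 2f_k`), so `(0,1)` is the recessive side.  Proved here:
* `eventually_pos_mul_of_root` / `eventually_pos_mul_of_ne` / `exists_delta_of_eventually` — local sign lemmas just left of a point;
* `eval_one_mul_succ`, `eval_one_eq_sign` — at the resonance `x = 1`: `D_j(1)D_{j+1}(1) = [j ≡ 0 (mod 3)]` (resonance law of `…UnitSmall`);
  `prev_mul_deriv_one_neg` — for `k ≡ 2 (mod 3)`: `D_{k−1}(1)·D_k′(1) < 0` (the Jacobi step of `…UnitWronskian` at the resonance zero);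
* `eventually_signTable_near_one` — just below `1` every `D_k` (`k ≤ m`) has the sign `+` for `k mod 6 ∈ {0,1,2}` and `−` otherwise;
  `sturmCount_of_signTable`, `card_filter_mod_three` — hence the Sturm count there is `#{k < m : k ≡ 2 (mod 3)} = ⌊m/3⌋`;
* **THE RECESSIVE COUNT LAW** (`card_roots_unit_interval_eq_div_three`): for `3 ≤ m ≤ 8`, all slopes positive and every zero of `D_m` in `(0,1)`
  non-degenerate (`D_1, …, D_{m−1} ≠ 0` there), the zeros of `D_m` in `(0,1)` counted with multiplicity number EXACTLY `⌊m/3⌋` — for ALL exponents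
  (the constant column «below = ⌊m/3⌋» of the located censuses, now a theorem up to `m = 8`; FALSE from `m = 9` on without a separation hypothesis,
  memo CROSSING-DIRECTION-liftp1g18.md §3: an explicit integer design of size 9 has five such zeros).
Nothing here is an upper law for the register (α NO MOVER); nothing bears on `WeakLifting` / `TropicalB` (stmt-19771) in their windows, Conjecture B,
the Door-A registers, `MatrixDescartes` (stmt-18050) or VP ≠ VNP.
[this seat; folklore: Sturm sequences, first-order sign analysis at a simple zero]
-/

-- `Summit.ValiantsHypothesis.ValiantsHypothesis.…` repeats a component by the D-0017 layout (single-conjunct summit); the name is mandated.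
set_option linter.dupNamespace false
set_option autoImplicit false

namespace Summit.ValiantsHypothesis.ValiantsHypothesis.Theorems.KPlusLogSqLaw
namespace StaticTridiagonalRealUnit

open Real Finset Polynomial Filter Topology
open Summit.ValiantsHypothesis.ValiantsHypothesis.Theorems.KPlusLogSqLaw.StaticTridiagonalRealPotential (pathDet)

variable (d : ℕ → ℕ) (f : ℕ → ℕ)

/-! ### 1. Local sign lemmas just left of a point -/

/-- a simple zero with `c·p′(1) < 0` has `c·p(x) > 0` just left of `1`. [folklore] -/
theorem eventually_pos_mul_of_root (p : ℝ[X]) (c : ℝ) (h1 : p.eval 1 = 0) (hd : c * (derivative p).eval 1 < 0) :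
    ∀ᶠ x in 𝓝[<] (1 : ℝ), 0 < c * p.eval x := by
  have hder : HasDerivAt (fun x => (C c * p).eval x) (c * (derivative p).eval 1) 1 := by
    have := (C c * p).hasDerivAt 1
    rwa [derivative_mul, derivative_C, zero_mul, zero_add, eval_mul, eval_C] at this
  rw [hasDerivAt_iff_tendsto_slope] at hder
  have hlt : ∀ᶠ x in 𝓝[≠] (1 : ℝ), (x - 1)⁻¹ • ((C c * p).eval x - (C c * p).eval 1) < 0 := hder (Iio_mem_nhds hd)
  have hlt' : ∀ᶠ x in 𝓝[<] (1 : ℝ), (x - 1)⁻¹ • ((C c * p).eval x - (C c * p).eval 1) < 0 :=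
    hlt.filter_mono (nhdsWithin_mono _ fun y hy => ne_of_lt hy)
  have hmem : ∀ᶠ x in 𝓝[<] (1 : ℝ), x < 1 := eventually_nhdsWithin_of_forall fun y hy => hy
  filter_upwards [hlt', hmem] with x hx hx1
  rw [eval_mul, eval_C, eval_mul, eval_C, h1, mul_zero, sub_zero, smul_eq_mul] at hx
  have hneg : (x - 1)⁻¹ < 0 := inv_lt_zero.2 (by linarith)
  rcases lt_or_ge 0 (c * p.eval x) with h | h
  · exact h
  · exfalso; linarith [mul_nonneg_of_nonpos_of_nonpos hneg.le h]

/-- a polynomial keeps the sign of a non-zero value just left of the point. [folklore] -/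
theorem eventually_pos_mul_of_ne (p : ℝ[X]) (h1 : p.eval 1 ≠ 0) :
    ∀ᶠ x in 𝓝[<] (1 : ℝ), 0 < p.eval 1 * p.eval x := by
  have hcont : ContinuousAt (fun x => p.eval 1 * p.eval x) 1 := by fun_prop
  have hpos : 0 < p.eval 1 * p.eval 1 := mul_self_pos.2 h1
  have h := hcont.eventually (Ioi_mem_nhds hpos)
  exact h.filter_mono nhdsWithin_le_nhds

/-- extraction of an explicit left neighbourhood. [bookkeeping] -/
theorem exists_delta_of_eventually {P : ℝ → Prop} (h : ∀ᶠ x in 𝓝[<] (1 : ℝ), P x) :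
    ∃ δ > 0, ∀ x, 1 - δ < x → x < 1 → P x := by
  rw [eventually_nhdsWithin_iff, Metric.eventually_nhds_iff] at h
  obtain ⟨ε, hε, hball⟩ := h
  refine ⟨ε, hε, fun x hx1 hx2 => hball ?_ hx2⟩
  rw [Real.dist_eq, abs_lt]
  constructor <;> linarith

/-! ### 2. At the resonance `x = 1` -/

/-- `D_j(1)·D_{j+1}(1) = 1` if `j ≡ 0 (mod 3)`, else `0` (resonance law: the values at `1` are `1,1,0,−1,−1,0,…`). [this file] -/
theorem eval_one_mul_succ (j : ℕ) :
    (pathDet (fun _ => (1 : ℝ)) d (fun _ => (1 : ℝ)) f j).eval 1 * (pathDet (fun _ => (1 : ℝ)) d (fun _ => (1 : ℝ)) f (j + 1)).eval 1 =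
      if j % 3 = 0 then 1 else 0 := by
  rw [eval_one_unit d f j, eval_one_unit d f (j + 1)]
  have h6 : j % 6 = 0 ∨ j % 6 = 1 ∨ j % 6 = 2 ∨ j % 6 = 3 ∨ j % 6 = 4 ∨ j % 6 = 5 := by omega
  rcases h6 with h | h | h | h | h | h <;>
    · have h' : (j + 1) % 6 = (j % 6 + 1) % 6 := by omega
      rw [h] at h'
      norm_num at h'
      have h3 : j % 3 = j % 6 % 3 := by omega
      rw [h] at h3
      norm_num at h3
      simp [h, h', h3]

/-- the value at `1` in closed form: `σ`-sign with a zero every third index. [this file] -/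
theorem eval_one_eq_sign (k : ℕ) :
    (pathDet (fun _ => (1 : ℝ)) d (fun _ => (1 : ℝ)) f k).eval 1 =
      if k % 3 = 2 then 0 else if k % 6 < 3 then 1 else -1 := by
  rw [eval_one_unit d f k]
  have h6 : k % 6 = 0 ∨ k % 6 = 1 ∨ k % 6 = 2 ∨ k % 6 = 3 ∨ k % 6 = 4 ∨ k % 6 = 5 := by omega
  rcases h6 with h | h | h | h | h | h <;>
    · have h3 : k % 3 = k % 6 % 3 := by omega
      rw [h] at h3
      norm_num at h3
      simp [h, h3]

/-- **at a resonance zero the derivative points against the previous continuant**: for `k = n + 2 ≡ 2 (mod 3)` (so `D_k(1) = 0`) and all slopes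
positive, `D_{k−1}(1)·D_k′(1) = −Σ_{j ≡ 0 (3), j ≤ k−2} L_j < 0` (the Jacobi step of `…UnitWronskian` at `x = 1`). [this file] -/
theorem prev_mul_deriv_one_neg (n : ℕ) (hslope : ∀ k, k + 1 < n + 2 → d k + d (k + 1) < 2 * f k)
    (hroot : (pathDet (fun _ => (1 : ℝ)) d (fun _ => (1 : ℝ)) f (n + 2)).eval 1 = 0) :
    (pathDet (fun _ => (1 : ℝ)) d (fun _ => (1 : ℝ)) f (n + 1)).eval 1 *
      (derivative (pathDet (fun _ => (1 : ℝ)) d (fun _ => (1 : ℝ)) f (n + 2))).eval 1 < 0 := by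
  have hJ := deriv_mul_prev_eq_neg_slopeEnergy d f n 1 one_pos hroot
  simp only [one_pow, div_one, one_mul] at hJ
  rw [hJ, neg_lt_zero]
  have hterm : ∀ k ∈ range (n + 1), ((2 * (f k : ℝ)) - ((d k + d (k + 1) : ℕ) : ℝ)) *
      ((pathDet (fun _ => (1 : ℝ)) d (fun _ => (1 : ℝ)) f k).eval 1 * (pathDet (fun _ => (1 : ℝ)) d (fun _ => (1 : ℝ)) f (k + 1)).eval 1) =
      if k % 3 = 0 then ((2 * (f k : ℝ)) - ((d k + d (k + 1) : ℕ) : ℝ)) else 0 := by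
    intro k _
    rw [eval_one_mul_succ]; split_ifs <;> ring
  rw [sum_congr rfl hterm]
  refine Finset.sum_pos' (fun k hk => ?_) ⟨0, by simp, ?_⟩
  · rw [mem_range] at hk
    have := hslope k (by omega)
    split_ifs
    · have : ((d k + d (k + 1) : ℕ) : ℝ) < 2 * (f k : ℝ) := by exact_mod_cast this
      linarith
    · exact le_rfl
  · rw [if_pos rfl]
    have := hslope 0 (by omega)
    have : ((d 0 + d (0 + 1) : ℕ) : ℝ) < 2 * (f 0 : ℝ) := by exact_mod_cast this
    linarith

/-! ### 3. The sign table just below the resonance -/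

/-- **sign table near `1⁻`**: for every `k ≤ m`, just below `1` the continuant `D_k` has the sign `+` if `k mod 6 < 3` and `−` otherwise
(all slopes positive). [this file] -/
theorem eventually_signTable_near_one (m : ℕ) (hslope : ∀ k, k + 1 < m → d k + d (k + 1) < 2 * f k) (k : ℕ) (hk : k ≤ m) :
    ∀ᶠ x in 𝓝[<] (1 : ℝ), 0 < (if k % 6 < 3 then (1 : ℝ) else -1) * (pathDet (fun _ => (1 : ℝ)) d (fun _ => (1 : ℝ)) f k).eval x := by
  by_cases hk3 : k % 3 = 2
  · -- resonance zero: first-order sign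
    obtain ⟨n, rfl⟩ : ∃ n, k = n + 2 := ⟨k - 2, by omega⟩
    have hroot : (pathDet (fun _ => (1 : ℝ)) d (fun _ => (1 : ℝ)) f (n + 2)).eval 1 = 0 := by
      rw [eval_one_eq_sign, if_pos hk3]
    have hder := prev_mul_deriv_one_neg d f n (fun j hj => hslope j (by omega)) hroot
    have hprev : (pathDet (fun _ => (1 : ℝ)) d (fun _ => (1 : ℝ)) f (n + 1)).eval 1 = if (n + 2) % 6 < 3 then (1 : ℝ) else -1 := by
      rw [eval_one_eq_sign, if_neg (by omega)]
      by_cases h : (n + 2) % 6 < 3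
      · rw [if_pos h, if_pos (by omega)]
      · rw [if_neg h, if_neg (by omega)]
    rw [hprev] at hder
    exact eventually_pos_mul_of_root _ _ hroot hder
  · -- non-zero value at `1`: continuity
    have hval : (pathDet (fun _ => (1 : ℝ)) d (fun _ => (1 : ℝ)) f k).eval 1 = if k % 6 < 3 then (1 : ℝ) else -1 := by
      rw [eval_one_eq_sign, if_neg hk3]
    have hne : (pathDet (fun _ => (1 : ℝ)) d (fun _ => (1 : ℝ)) f k).eval 1 ≠ 0 := by
      rw [hval]; split_ifs <;> norm_num
    have h := eventually_pos_mul_of_ne _ hne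
    rw [hval] at h
    exact h

/-- the number of indices `k < m` with `k ≡ 2 (mod 3)` is `⌊m/3⌋`. [bookkeeping] -/
theorem card_filter_mod_three (m : ℕ) : (Finset.univ.filter fun k : Fin m => (k : ℕ) % 3 = 2).card = m / 3 := by
  rw [Finset.card_filter, Fin.sum_univ_eq_sum_range (fun k => if k % 3 = 2 then 1 else 0) m]
  induction m with
  | zero => simp
  | succ m ih =>
    rw [sum_range_succ, ih]
    split_ifs with h <;> omega

/-- **Sturm count from the sign table**: if every `D_k(x)` (`k ≤ m`) has the sign of the table, the Sturm count at `x` is `⌊m/3⌋` and no `D_k(x)`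
vanishes. [this file] -/
theorem sturmCount_of_signTable (m : ℕ) (x : ℝ)
    (hsign : ∀ k, k ≤ m → 0 < (if k % 6 < 3 then (1 : ℝ) else -1) * (pathDet (fun _ => (1 : ℝ)) d (fun _ => (1 : ℝ)) f k).eval x) :
    (Finset.univ.filter fun k : Fin m =>
        (pathDet (fun _ => (1 : ℝ)) d (fun _ => (1 : ℝ)) f k).eval x * (pathDet (fun _ => (1 : ℝ)) d (fun _ => (1 : ℝ)) f (k + 1)).eval x < 0).card =
      m / 3 ∧ ∀ k, k ≤ m → (pathDet (fun _ => (1 : ℝ)) d (fun _ => (1 : ℝ)) f k).eval x ≠ 0 := by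
  have hne : ∀ k, k ≤ m → (pathDet (fun _ => (1 : ℝ)) d (fun _ => (1 : ℝ)) f k).eval x ≠ 0 := by
    intro k hk h0
    have := hsign k hk
    rw [h0, mul_zero] at this
    exact lt_irrefl _ this
  refine ⟨?_, hne⟩
  rw [← card_filter_mod_three m]
  congr 1
  refine Finset.filter_congr fun k _ => ?_
  have h1 := hsign k (by omega)
  have h2 := hsign (k + 1) (by omega)
  -- the product has the sign of `σ_k σ_{k+1}`, which is negative exactly when `k ≡ 2 (mod 3)`
  have key : ((k : ℕ) % 6 < 3 ↔ ((k : ℕ) + 1) % 6 < 3) ↔ ¬ ((k : ℕ) % 3 = 2) := by omega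
  constructor
  · intro hlt
    by_contra h3
    have hsame : ((k : ℕ) % 6 < 3 ↔ ((k : ℕ) + 1) % 6 < 3) := key.2 h3
    by_cases ha : (k : ℕ) % 6 < 3
    · have hb := hsame.1 ha
      rw [if_pos ha, one_mul] at h1
      rw [if_pos hb, one_mul] at h2
      nlinarith
    · have hb : ¬ ((k : ℕ) + 1) % 6 < 3 := fun hb => ha (hsame.2 hb)
      rw [if_neg ha] at h1
      rw [if_neg hb] at h2
      nlinarith
  · intro h3
    have hdiff : ¬ ((k : ℕ) % 6 < 3 ↔ ((k : ℕ) + 1) % 6 < 3) := fun h => key.1 h h3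
    by_cases ha : (k : ℕ) % 6 < 3
    · have hb : ¬ ((k : ℕ) + 1) % 6 < 3 := fun hb => hdiff ⟨fun _ => hb, fun _ => ha⟩
      rw [if_pos ha, one_mul] at h1
      rw [if_neg hb] at h2
      nlinarith
    · have hb : ((k : ℕ) + 1) % 6 < 3 := by
        by_contra hb; exact hdiff ⟨fun h => absurd h ha, fun h => absurd h hb⟩
      rw [if_neg ha] at h1
      rw [if_pos hb, one_mul] at h2
      nlinarith

/-! ### 4. The recessive count law -/

/-- **THE RECESSIVE COUNT LAW (`3 ≤ m ≤ 8`, all exponents).**  For a unit-coefficient static symmetric tridiagonal design of size `m ≤ 8` with all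
edge slopes positive (`d_k + d_{k+1} < 2f_k`) whose determinant zeros in `(0,1)` are non-degenerate (`D_1, …, D_{m−1} ≠ 0` at each of them), the
zeros of `D_m` in the recessive unit interval `(0,1)` counted with multiplicity number EXACTLY `⌊m/3⌋`. [this file] -/
theorem card_roots_unit_interval_eq_div_three (m : ℕ) (hm : 3 ≤ m) (hm8 : m ≤ 8)
    (hslope : ∀ k, k + 1 < m → d k + d (k + 1) < 2 * f k)
    (hnd : ∀ t, 0 < t → t < 1 → (pathDet (fun _ => (1 : ℝ)) d (fun _ => (1 : ℝ)) f m).eval t = 0 →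
      ∀ k, 0 < k → k < m → (pathDet (fun _ => (1 : ℝ)) d (fun _ => (1 : ℝ)) f k).eval t ≠ 0) :
    Multiset.card ((pathDet (fun _ => (1 : ℝ)) d (fun _ => (1 : ℝ)) f m).roots.filter (fun t => 0 < t ∧ t < 1)) = m / 3 := by
  -- a scale `b` just below `1` carrying the sign table, beyond which `D_m` has no zero
  have hev : ∀ᶠ x in 𝓝[<] (1 : ℝ), ∀ k ∈ range (m + 1),
      0 < (if k % 6 < 3 then (1 : ℝ) else -1) * (pathDet (fun _ => (1 : ℝ)) d (fun _ => (1 : ℝ)) f k).eval x :=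
    (Finset.eventually_all (range (m + 1))).2 fun k hk =>
      eventually_signTable_near_one d f m hslope k (by rw [mem_range] at hk; omega)
  obtain ⟨δ, hδ, hnear⟩ := exists_delta_of_eventually hev
  set b : ℝ := 1 - min δ 1 / 2 with hb_def
  have hmin : 0 < min δ 1 := lt_min hδ one_pos
  have hb0 : 0 < b := by rw [hb_def]; have := min_le_right δ 1; linarith
  have hb1 : b < 1 := by rw [hb_def]; linarith
  have hbδ : 1 - δ < b := by rw [hb_def]; have := min_le_left δ 1; linarith
  have hsignAt : ∀ x, b ≤ x → x < 1 → ∀ k, k ≤ m →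
      0 < (if k % 6 < 3 then (1 : ℝ) else -1) * (pathDet (fun _ => (1 : ℝ)) d (fun _ => (1 : ℝ)) f k).eval x :=
    fun x hx1 hx2 k hk => hnear x (by linarith) hx2 k (by rw [mem_range]; omega)
  obtain ⟨hV, hbne⟩ := sturmCount_of_signTable d f m b (hsignAt b le_rfl hb1)
  have hbelow := card_roots_below_eq_sturm_of_le_eight d f m hm hm8 hb0 hb1 hslope hbne
    (fun t ht htb => hnd t ht (htb.trans hb1))
  rw [hV] at hbelow
  rw [← hbelow]
  congr 1
  refine Multiset.filter_congr fun t ht => ⟨fun h => ⟨h.1, ?_⟩, fun h => ⟨h.1, h.2.trans hb1⟩⟩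
  by_contra hge
  have hroot : (pathDet (fun _ => (1 : ℝ)) d (fun _ => (1 : ℝ)) f m).eval t = 0 := (mem_roots'.1 ht).2
  have := hsignAt t (not_lt.1 hge) h.2 m le_rfl
  rw [hroot, mul_zero] at this
  exact lt_irrefl _ this

end StaticTridiagonalRealUnit
end Summit.ValiantsHypothesis.ValiantsHypothesis.Theorems.KPlusLogSqLaw
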